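import Literature.NumberTheory.Automorphic.VarmaUnramifiedWeilTraces
import Literature.NumberTheory.Automorphic.AdicCompletionResidueCard
import Literature.NumberTheory.Automorphic.HarrisLanTaylorThorneThm713
import Literature.NumberTheory.GaloisRepresentations.DecompositionGroupOfCompletion
import Literature.NumberTheory.GaloisRepresentations.LocalGaloisGroupFrobeniusProofs
import Literature.NumberTheory.GaloisRepresentations.GaloisRepOfLadicLimit
import Summits.Langlands.Langlands.Theorems.PicardMuOrdinaryMuOrdinaryFamilyRTDictionary
import Summits.Langlands.Langlands.Theorems.IrreducibilityBySelfDualityGaloisRepOfRegularAlgebraicOfWeilTraces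
import HarnessLib

/-!
# `VarmaWeilTracesUnramified` (stmt-Langlands-15004, route IrreducibilityBySelfDuality): the Weil
# traces of an HLTT-compatible Galois representation at the unramified places

The item (child 4/4 of the crux `GaloisRepOfRegularAlgebraic`, stmt-Langlands-10785; = the
registered stub S2 `stub_weilTracesNonzeroDeg` of line `Sketch`) is Varma's Theorem 1 at the
unramified places in trace form, non-zero degree: for `K` totally real or CM, `π` cuspidal regular
algebraic on `GL_n(𝔸_K)`, `r : Γ_K → GL_n(ℚ̄_ℓ)` continuous semisimple with Harris–Lan–Taylor–Thorne's
property `IsCompatible π ι r`, `v ∤ ℓ` with Satake parameter `α`, every `σ ∈ Γ_{K_v}` acting on the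
residue field as the `d`-th power of the arithmetic Frobenius, `d ≠ 0`, has `tr r(σ) = ∑_j b_j ^ d`,
`b_j` the roots of `arithFrobPolyOfSatake ι q_v n α`.  It is the Literature named fact
`Varma2024.theorem1_unramified_traces` (`VarmaUnramifiedWeilTraces`) restricted to `d ≠ 0`; the
printed proof (Varma, Forum Math. Sigma 12 (2024) e21, §§5–7: ordinary `p`-adic automorphic forms on
`U(n,n)` and the Bernstein centre) is far outside the tree.  This file does NOT import the Theses
file; every theorem is stated on the item's text.  It records, sorry-free on the standard axioms:

* `trace_toLocal_eq_of_isUnramifiedAt_of_hasFrobCharpolyAt` — **the local engine** (the converse of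
  the landed `stub_localRigidity`): a continuous `r : Γ_K → GL_n(k)`, `k` algebraically closed,
  unramified at `v` with arithmetic-Frobenius polynomial `∏ (X - b)`, has `tr r(σ) = ∑ b ^ d` for
  every `σ ∈ Γ_{K_v}` of Frobenius degree `d ∈ ℤ` (local arithmetic Frobenius
  `exists_isAbsArithFrob_holds`; `σ φ^{-d}` inertial, `IsFrobPow.mul_inv_mem_absInertia_holds`; the
  dictionary `inertia_adicCompletionPrime_eq_map_absInertia`,
  `isArithFrobAt_absGaloisRestrict_adicCompletionPrime_iff`; traces of integer powers from the
  characteristic polynomial, `trace_units_zpow_eq_sum_roots_zpow`).  In particular the item's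
  Frobenius convention (`IsFrobPow σ 1` = arithmetic, `b_j` = arithmetic-Frobenius roots, `b ^ d`
  not `b ^ (-d)`) is the one of `IsCompatible` / `HasFrobCharpolyAt`: the statement is not mis-stated.
* `trace_toLocal_eq_of_isCompatible_of_isUnramifiedAbove`, `eventually_trace_toLocal_eq_of_isCompatible`
  — **what Thm. A already gives, unconditionally**: the item's conclusion (all `d`) at every place
  over a rational prime `q ≠ ℓ` above which `π` is unramified, hence at all but finitely many places.
  What is left — the unramified `π_v` over the finitely many rational primes above which `π`
  ramifies somewhere — is exactly Varma's Theorem 1.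
* `of_rank_le_one` — **the item in ranks `n ≤ 1`, unconditionally** (Weil 1956 via the landed
  `GaloisRepOfRegularAlgebraic.of_rank_le_one`, the proved uniqueness clause of Thm. A
  `theoremA_uniqueness_holds`, and `IsGaloisCompatibleAt.of_equiv`).
* `of_corollary93_unramified`, `iff_corollary93_unramified`, `of_exists_galoisRep_of_regularAlgebraic`,
  `of_theorem1_unramified_traces` — **the item is equivalent in the tree to the Varma leaf
  `Varma2024.corollary93_unramified`** (forward: the landed composition
  `corollary93_unramified_of_weilTraces` of line `Sketch`; backward: the local engine) and follows in
  one line from each of the three existing named facts `Varma2024.theorem1_unramified_traces`,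
  `Varma2024.corollary93_unramified`, `exists_galoisRep_of_regularAlgebraic` (lang.S27).

References: I. Varma, Forum Math. Sigma 12 (2024) e21, Thm. 1 (p. 2), Cor. 9.3 (p. 32) [VarmaFMS2024];
M. Harris, K.-W. Lan, R. Taylor, J. Thorne, Res. Math. Sci. 3:37 (2016), Thm. A (p. 3)
[HarrisLanTaylorThorneRMS2016]; J. Tate, *Number theoretic background*, Corvallis 1979, §1.4, §4.2
[TateCorvallis1979]; J.-P. Serre, *Abelian ℓ-adic representations* (1968), Ch. I §2.1
[SerreAbelianLadic1968]; A. Weil, *On a certain type of characters …* (1956) [Weil1956].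
-/

noncomputable section

set_option linter.dupNamespace false

open scoped MatrixGroups Matrix NumberField Polynomial Classical
open NumberField IsDedekindDomain Field Polynomial
open Literature.NumberTheory.Automorphic Literature.NumberTheory.GaloisRepresentations
open Literature.NumberTheory.Automorphic.HarrisLanTaylorThorne2016
open Literature.NumberTheory.GaloisRepresentations.IsNonarchimedeanLocalField (residueFieldCard)

namespace Summit.Langlands.Langlands.Theorems.VarmaWeilTracesUnramified

/-! ### Linear algebra: traces of integer powers -/

/-- Over an algebraically closed field, an invertible matrix with characteristic polynomial
`∏_{b ∈ β} (X - b)` has `tr (M ^ d) = ∑_{b ∈ β} b ^ d` for every INTEGER `d` (for `d ≥ 0` this is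
`LadicLimit.matrix_trace_pow_eq_sum_roots_pow`; for `d < 0` the characteristic polynomial of `M⁻¹`
is `∏ (X - b⁻¹)`, `charpoly_inv_of_charpoly_eq_prod`). [folklore] -/
theorem trace_units_zpow_eq_sum_roots_zpow {k : Type*} [Field k] [IsAlgClosed k] {n : ℕ}
    (M : GL (Fin n) k) (β : Multiset k)
    (hM : (M : Matrix (Fin n) (Fin n) k).charpoly = (β.map fun b => X - C b).prod) (d : ℤ) :
    ((M ^ d : GL (Fin n) k) : Matrix (Fin n) (Fin n) k).trace = (β.map fun b => b ^ d).sum := by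
  classical
  obtain ⟨m, rfl | rfl⟩ := d.eq_nat_or_neg
  · rw [zpow_natCast, Units.val_pow_eq_pow_val, LadicLimit.matrix_trace_pow_eq_sum_roots_pow, hM,
      roots_multiset_prod_X_sub_C]
    simp only [zpow_natCast]
  · have hinv : ((M : Matrix (Fin n) (Fin n) k)⁻¹).charpoly = (β.map fun b => X - C b⁻¹).prod :=
      Summit.Langlands.Langlands.Cruxes.MuOrdinaryFamilyRT.CharZeroDominance.charpoly_inv_of_charpoly_eq_prod
        (Units.isUnit M) hM
    rw [zpow_neg, zpow_natCast, ← inv_pow, Units.val_pow_eq_pow_val, Matrix.coe_units_inv,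
      LadicLimit.matrix_trace_pow_eq_sum_roots_pow, hinv]
    have : (β.map fun b => X - C b⁻¹) = ((β.map fun b => b⁻¹).map fun c => X - C c) := by
      rw [Multiset.map_map]; rfl
    rw [this, roots_multiset_prod_X_sub_C, Multiset.map_map]
    refine congrArg _ (Multiset.map_congr rfl fun b _ => ?_)
    simp only [Function.comp_apply, zpow_neg, zpow_natCast, inv_pow]

/-! ### The local engine: Weil traces of an unramified representation -/

/-- **Weil traces of an unramified representation (the converse of local rigidity).**  Let `K` be a
number field, `v` a finite place, `r : Γ_K → GL_n(k)` a continuous representation over an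
algebraically closed field `k`, unramified at `v` and with arithmetic-Frobenius characteristic
polynomial `∏_{b ∈ β} (X - b)` at `v`.  Then every `σ ∈ Γ_{K_v}` acting on the residue field as the
`d`-th power of the arithmetic Frobenius (`IsFrobPow σ d`, `d : ℤ`) has `tr r(σ) = ∑_{b ∈ β} b ^ d`:
`σ = ι · φ ^ d` with `φ` a local arithmetic Frobenius (`exists_isAbsArithFrob_holds`) and `ι`
inertial (`IsFrobPow.mul_inv_mem_absInertia_holds`), the local inertia maps into the global inertia
group of the prime `𝔓₀` cut out by `K̄ → \bar K_v` (`inertia_adicCompletionPrime_eq_map_absInertia`),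
and the restriction of `φ` is an arithmetic Frobenius at `𝔓₀`
(`isArithFrobAt_absGaloisRestrict_adicCompletionPrime_iff`).  [cite: TateCorvallis1979, §4.2 (4.2.1)]
[cite: SerreAbelianLadic1968, Ch. I §2.1] -/
theorem trace_toLocal_eq_of_isUnramifiedAt_of_hasFrobCharpolyAt {K : Type} [Field K] [NumberField K]
    {k : Type*} [Field k] [TopologicalSpace k] [IsAlgClosed k] {n : ℕ}
    (v : HeightOneSpectrum (𝓞 K)) (r : FramedGaloisRep K k n) (β : Multiset k)
    (hunr : r.IsUnramifiedAt v) (hfrob : r.HasFrobCharpolyAt v ((β.map fun b => X - C b).prod))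
    (σ : absoluteGaloisGroup (v.adicCompletion K)) (d : ℤ) (hσ : IsFrobPow σ d) :
    (((r.toLocal v) σ : GL (Fin n) k) : Matrix (Fin n) (Fin n) k).trace = (β.map fun b => b ^ d).sum := by
  classical
  -- a local arithmetic Frobenius `φ` and its powers
  obtain ⟨φ, hφ⟩ := exists_isAbsArithFrob_holds (v.adicCompletion K)
  have h1 : IsFrobPow φ 1 := IsAbsArithFrob.isFrobPow_holds hφ
  have hφd : IsFrobPow (φ ^ d) d := by simpa using h1.zpow d
  -- `σ (φ ^ d)⁻¹` is inertial, hence killed by `r`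
  have hin : σ * (φ ^ d)⁻¹ ∈ absInertia (v.adicCompletion K) :=
    IsFrobPow.mul_inv_mem_absInertia_holds hσ hφd
  have hker : r.toLocal v (σ * (φ ^ d)⁻¹) = 1 := by
    rw [FramedGaloisRep.toLocal_apply]
    refine hunr _ (adicCompletionPrime_mem_primesAbove K v) _ ?_
    rw [inertia_adicCompletionPrime_eq_map_absInertia]
    exact Subgroup.mem_map_of_mem _ hin
  have hσeq : r.toLocal v σ = (r.toLocal v φ) ^ d := by
    have : σ = (σ * (φ ^ d)⁻¹) * φ ^ d := by group
    rw [this, map_mul, hker, one_mul, map_zpow]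
  -- the restriction of `φ` is an arithmetic Frobenius at `𝔓₀`, so `charpoly r(φ) = ∏ (X - b)`
  have hqN : residueFieldCard (v.adicCompletion K) = Nat.card (𝓞 K ⧸ v.asIdeal) :=
    (residueFieldCard_adicCompletion_eq K v).trans (HeightOneSpectrum.residueCard_eq_card_quotient v)
  have hF : IsArithFrobAt (𝓞 K) (absGaloisRestrict K (v.adicCompletion K) φ)
      (adicCompletionPrime K v) :=
    (isArithFrobAt_absGaloisRestrict_adicCompletionPrime_iff K v hqN φ).mpr hφ
  have hM : (((r.toLocal v φ : GL (Fin n) k)) : Matrix (Fin n) (Fin n) k).charpoly =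
      (β.map fun b => X - C b).prod :=
    hfrob _ (adicCompletionPrime_mem_primesAbove K v) _ hF
  rw [hσeq]
  exact trace_units_zpow_eq_sum_roots_zpow _ β hM d

/-- The same with the conclusion phrased through `IsGaloisCompatibleAt`: if `r` is compatible with
`π` at `v` (unramified, with Frobenius polynomial `arithFrobPolyOfSatake ι q_v n α` for the Satake
parameter `α`), then the Weil traces at `v` are the power sums of the roots of that polynomial.
[cite: TateCorvallis1979, §4.2 (4.2.1)] -/
theorem trace_toLocal_eq_of_isGaloisCompatibleAt {n : ℕ} {K : Type} [Field K] [NumberField K]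
    {hcpt : isCompact_glFiniteIntegralLevel n K} {ℓ : ℕ} [Fact ℓ.Prime]
    (π : AutomorphicRepData (AutomorphyDatum.gl n K hcpt)) (ι : PadicAlgCl ℓ ≃+* ℂ)
    (r : FramedGaloisRep K (PadicAlgCl ℓ) n) (v : HeightOneSpectrum (𝓞 K))
    (hc : IsGaloisCompatibleAt π ι r v) (α : Multiset ℂ) (hα : π.HasSatakeParamAt v α)
    (σ : absoluteGaloisGroup (v.adicCompletion K)) (d : ℤ) (hσ : IsFrobPow σ d) :
    (((r.toLocal v) σ : GL (Fin n) (PadicAlgCl ℓ)) : Matrix (Fin n) (Fin n) (PadicAlgCl ℓ)).trace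
      = ((arithFrobPolyOfSatake ι v.residueCard n α).roots.map fun b => b ^ d).sum := by
  obtain ⟨hunr, hfrob⟩ := hc α hα
  rw [arithFrobPolyOfSatake_eq_prod_roots] at hfrob
  exact trace_toLocal_eq_of_isUnramifiedAt_of_hasFrobCharpolyAt v r _ hunr hfrob σ d hσ

/-! ### What HLTT's Theorem A already gives: the places over good rational primes -/

/-- **The item at the places over HLTT-good rational primes, unconditionally.**  For ANY number
field `K`, any `π` (Borel–Jacquet datum) and any `r : Γ_K → GL_n(ℚ̄_ℓ)` with Harris–Lan–Taylor–Thorne's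
property `IsCompatible π ι r`: if `v` lies over a rational prime `q ≠ ℓ` above which `π` is
unramified (`IsUnramifiedAbove`), then every `σ ∈ Γ_{K_v}` of Frobenius degree `d` (any `d : ℤ`) has
`tr r(σ) = ∑_b b ^ d` over the roots `b` of `arithFrobPolyOfSatake ι q_v n α`.  So the content of
the item `VarmaWeilTracesUnramified` beyond Thm. A is exactly the unramified places `v` over the
finitely many rational primes above which `π` ramifies somewhere — Varma's Theorem 1.
[cite: HarrisLanTaylorThorneRMS2016, Thm. A (p. 3)] [cite: TateCorvallis1979, §4.2 (4.2.1)] -/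
theorem trace_toLocal_eq_of_isCompatible_of_isUnramifiedAbove {n : ℕ} {K : Type} [Field K]
    [NumberField K] {hcpt : isCompact_glFiniteIntegralLevel n K} {ℓ : ℕ} [Fact ℓ.Prime]
    (π : AutomorphicRepData (AutomorphyDatum.gl n K hcpt)) (ι : PadicAlgCl ℓ ≃+* ℂ)
    (r : FramedGaloisRep K (PadicAlgCl ℓ) n) (hc : IsCompatible π ι r)
    {q : ℕ} (hq : q.Prime) (hqℓ : q ≠ ℓ) (hπq : π.IsUnramifiedAbove q)
    (v : HeightOneSpectrum (𝓞 K)) (hv : ((q : ℕ) : 𝓞 K) ∈ v.asIdeal)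
    (α : Multiset ℂ) (hα : π.HasSatakeParamAt v α)
    (σ : absoluteGaloisGroup (v.adicCompletion K)) (d : ℤ) (hσ : IsFrobPow σ d) :
    (((r.toLocal v) σ : GL (Fin n) (PadicAlgCl ℓ)) : Matrix (Fin n) (Fin n) (PadicAlgCl ℓ)).trace
      = ((arithFrobPolyOfSatake ι v.residueCard n α).roots.map fun b => b ^ d).sum :=
  trace_toLocal_eq_of_isGaloisCompatibleAt π ι r v (hc q hq hqℓ hπq v hv) α hα σ d hσ

/-- **The item almost everywhere, unconditionally.**  For any number field `K`, any `π` and any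
`r` with Harris–Lan–Taylor–Thorne's property `IsCompatible π ι r`, at all but finitely many finite
places `v` (the exceptions lie over `ℓ` or over a rational prime below one of the finitely many
ramified places of `π` — Flath, `hasSatakeParamAt_cofinite_holds`; bookkeeping
`eventually_isGaloisCompatibleAt_of_isCompatible`) every `σ ∈ Γ_{K_v}` of Frobenius degree `d` has
`tr r(σ) = ∑_b b ^ d` over the roots `b` of `arithFrobPolyOfSatake ι q_v n α`, `α` any Satake
parameter of `π` at `v`. [cite: HarrisLanTaylorThorneRMS2016, Thm. A (p. 3)]
[cite: TateCorvallis1979, §4.2 (4.2.1)] -/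
theorem eventually_trace_toLocal_eq_of_isCompatible {n : ℕ} {K : Type} [Field K]
    [NumberField K] {hcpt : isCompact_glFiniteIntegralLevel n K} {ℓ : ℕ} [Fact ℓ.Prime]
    (π : AutomorphicRepData (AutomorphyDatum.gl n K hcpt)) (ι : PadicAlgCl ℓ ≃+* ℂ)
    (r : FramedGaloisRep K (PadicAlgCl ℓ) n) (hc : IsCompatible π ι r) :
    ∀ᶠ v : HeightOneSpectrum (𝓞 K) in Filter.cofinite,
      ∀ (α : Multiset ℂ), π.HasSatakeParamAt v α →
      ∀ (σ : absoluteGaloisGroup (v.adicCompletion K)) (d : ℤ), IsFrobPow σ d →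
        (((r.toLocal v) σ : GL (Fin n) (PadicAlgCl ℓ)) : Matrix (Fin n) (Fin n) (PadicAlgCl ℓ)).trace
          = ((arithFrobPolyOfSatake ι v.residueCard n α).roots.map fun b => b ^ d).sum :=
  (GaloisRepOfRegularAlgebraic.eventually_isGaloisCompatibleAt_of_isCompatible π ι r hc).mono
    fun v hv α hα σ d hσ => trace_toLocal_eq_of_isGaloisCompatibleAt π ι r v hv α hα σ d hσ

/-! ### Ranks `n ≤ 1`: the item unconditionally (Weil 1956 + Chebotarev) -/

/-- **In ranks `n ≤ 1` every HLTT-compatible semisimple `r` is compatible with `π` at every `v ∤ ℓ`,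
unconditionally** (`K` totally real or CM, `π` cuspidal regular algebraic on `GL_n(𝔸_K)`): the
tree proves lang.S27 in these ranks (`GaloisRepOfRegularAlgebraic.of_rank_le_one`: Weil's `ℓ`-adic
characters of algebraic Hecke characters), giving an `r₀` compatible at every `v ∤ ℓ`, in particular
HLTT-compatible (`isCompatible_of_forall_not_mem`); by the uniqueness clause of Thm. A — PROVED in
the tree from the Chebotarev density theorem (`theoremA_uniqueness_holds`) — `r₀ ≅ r`, and
compatibility at `v` is an isomorphism invariant (`IsGaloisCompatibleAt.of_equiv`).
[cite: Weil1956, §1–§2] [cite: HarrisLanTaylorThorneRMS2016, Thm. A (p. 3), uniqueness clause] -/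
theorem isGaloisCompatibleAt_of_rank_le_one {n : ℕ} (hn : n ≤ 1) {K : Type} [Field K]
    [NumberField K] (hcpt : isCompact_glFiniteIntegralLevel n K) (hK : IsTotallyReal K ∨ IsCMField K)
    (π : CuspidalAutomorphicRepData n K hcpt) (hπ : π.1.IsRegularAlgebraic) (ℓ : ℕ) [Fact ℓ.Prime]
    (ι : PadicAlgCl ℓ ≃+* ℂ) (r : FramedGaloisRep K (PadicAlgCl ℓ) n)
    (hr : r.toGaloisRep.IsSemisimple) (hc : IsCompatible π.1 ι r)
    (v : HeightOneSpectrum (𝓞 K)) (hv : ((ℓ : ℕ) : 𝓞 K) ∉ v.asIdeal) :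
    IsGaloisCompatibleAt π.1 ι r v := by
  obtain ⟨r₀, hr₀, hc₀⟩ := GaloisRepOfRegularAlgebraic.of_rank_le_one n hn K hcpt hK π hπ ℓ ι
  have hc₀' : ∀ w : HeightOneSpectrum (𝓞 K), ((ℓ : ℕ) : 𝓞 K) ∉ w.asIdeal →
      IsGaloisCompatibleAt π.1 ι r₀ w := fun w hw α hα => hc₀ w α hα hw
  obtain ⟨e⟩ := theoremA_uniqueness_holds hcpt hK π hπ ℓ ι r₀ r hr₀ hr
    (isCompatible_of_forall_not_mem hc₀') hc
  exact (hc₀' v hv).of_equiv e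

/-- **The item `VarmaWeilTracesUnramified` in ranks `n ≤ 1`, unconditionally** (and in every degree
`d`, zero included): `isGaloisCompatibleAt_of_rank_le_one` and the local engine
`trace_toLocal_eq_of_isGaloisCompatibleAt`. [cite: Weil1956, §1–§2]
[cite: HarrisLanTaylorThorneRMS2016, Thm. A (p. 3), uniqueness clause] -/
theorem of_rank_le_one :
    ∀ {n : ℕ}, n ≤ 1 → ∀ {K : Type} [Field K] [NumberField K]
      (hcpt : isCompact_glFiniteIntegralLevel n K),
      IsTotallyReal K ∨ IsCMField K →
      ∀ (π : CuspidalAutomorphicRepData n K hcpt), π.1.IsRegularAlgebraic →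
      ∀ (ℓ : ℕ) [Fact ℓ.Prime] (ι : PadicAlgCl ℓ ≃+* ℂ) (r : FramedGaloisRep K (PadicAlgCl ℓ) n),
        r.toGaloisRep.IsSemisimple → IsCompatible π.1 ι r →
        ∀ (v : HeightOneSpectrum (𝓞 K)), ((ℓ : ℕ) : 𝓞 K) ∉ v.asIdeal →
        ∀ (α : Multiset ℂ), π.1.HasSatakeParamAt v α →
        ∀ (σ : absoluteGaloisGroup (v.adicCompletion K)) (d : ℤ), IsFrobPow σ d →
          (((r.toLocal v) σ : GL (Fin n) (PadicAlgCl ℓ)) : Matrix (Fin n) (Fin n) (PadicAlgCl ℓ)).trace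
            = ((arithFrobPolyOfSatake ι v.residueCard n α).roots.map fun b => b ^ d).sum :=
  fun hn _ _ _ hcpt hK π hπ ℓ _ ι r hr hc v hv α hα σ d hσ =>
    trace_toLocal_eq_of_isGaloisCompatibleAt π.1 ι r v
      (isGaloisCompatibleAt_of_rank_le_one hn hcpt hK π hπ ℓ ι r hr hc v hv) α hα σ d hσ

/-! ### The item from the tree's Varma leaf `corollary93_unramified`, and conversely -/

/-- **The item from `Varma2024.corollary93_unramified`** (the tree's rendering of Varma's Cor. 9.3 at
unramified places: every semisimple `r` with HLTT's property is compatible with `π` at every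
`v ∤ ℓ`): compatibility at `v` gives the Weil traces at `v` in every degree
(`trace_toLocal_eq_of_isGaloisCompatibleAt`), in particular in non-zero degree — the text of the item
`VarmaWeilTracesUnramified` (stmt-Langlands-15004) verbatim. [cite: VarmaFMS2024, Thm. 1 and Cor. 9.3] -/
theorem of_corollary93_unramified (h93 : Varma2024.corollary93_unramified) :
    ∀ {n : ℕ} {K : Type} [Field K] [NumberField K] (hcpt : isCompact_glFiniteIntegralLevel n K),
      IsTotallyReal K ∨ IsCMField K →
      ∀ (π : CuspidalAutomorphicRepData n K hcpt), π.1.IsRegularAlgebraic →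
      ∀ (ℓ : ℕ) [Fact ℓ.Prime] (ι : PadicAlgCl ℓ ≃+* ℂ) (r : FramedGaloisRep K (PadicAlgCl ℓ) n),
        r.toGaloisRep.IsSemisimple → IsCompatible π.1 ι r →
        ∀ (v : HeightOneSpectrum (𝓞 K)), ((ℓ : ℕ) : 𝓞 K) ∉ v.asIdeal →
        ∀ (α : Multiset ℂ), π.1.HasSatakeParamAt v α →
        ∀ (σ : absoluteGaloisGroup (v.adicCompletion K)) (d : ℤ), d ≠ 0 → IsFrobPow σ d →
          (((r.toLocal v) σ : GL (Fin n) (PadicAlgCl ℓ)) : Matrix (Fin n) (Fin n) (PadicAlgCl ℓ)).trace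
            = ((arithFrobPolyOfSatake ι v.residueCard n α).roots.map fun b => b ^ d).sum :=
  fun hcpt hK π hπ ℓ _ ι r hr hc v hv α hα σ d _ hσ =>
    trace_toLocal_eq_of_isGaloisCompatibleAt π.1 ι r v (h93 hcpt hK π hπ ℓ ι r hr hc v hv) α hα σ d hσ

/-- **The item is equivalent, in the tree, to the Varma leaf `corollary93_unramified`**: the forward
direction is the landed composition of line `Sketch` (`corollary93_unramified_of_weilTraces`: Satake
gap of a cuspidal `π`, Grothendieck's monodromy theorem, local rigidity), the converse is
`of_corollary93_unramified`. [cite: VarmaFMS2024, Thm. 1 and Cor. 9.3] -/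
theorem iff_corollary93_unramified :
    (∀ {n : ℕ} {K : Type} [Field K] [NumberField K] (hcpt : isCompact_glFiniteIntegralLevel n K),
      IsTotallyReal K ∨ IsCMField K →
      ∀ (π : CuspidalAutomorphicRepData n K hcpt), π.1.IsRegularAlgebraic →
      ∀ (ℓ : ℕ) [Fact ℓ.Prime] (ι : PadicAlgCl ℓ ≃+* ℂ) (r : FramedGaloisRep K (PadicAlgCl ℓ) n),
        r.toGaloisRep.IsSemisimple → IsCompatible π.1 ι r →
        ∀ (v : HeightOneSpectrum (𝓞 K)), ((ℓ : ℕ) : 𝓞 K) ∉ v.asIdeal →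
        ∀ (α : Multiset ℂ), π.1.HasSatakeParamAt v α →
        ∀ (σ : absoluteGaloisGroup (v.adicCompletion K)) (d : ℤ), d ≠ 0 → IsFrobPow σ d →
          (((r.toLocal v) σ : GL (Fin n) (PadicAlgCl ℓ)) : Matrix (Fin n) (Fin n) (PadicAlgCl ℓ)).trace
            = ((arithFrobPolyOfSatake ι v.residueCard n α).roots.map fun b => b ^ d).sum) ↔
    Varma2024.corollary93_unramified :=
  ⟨fun h => GaloisRepOfRegularAlgebraic.corollary93_unramified_of_weilTraces h,
    fun h93 _ _ _ _ hcpt hK => of_corollary93_unramified h93 hcpt hK⟩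

/-- **The item from lang.S27** (`exists_galoisRep_of_regularAlgebraic`, the named fact behind the
parent crux `GaloisRepOfRegularAlgebraic`, stmt-Langlands-10785): lang.S27 gives the tree's Varma leaf
by the proved uniqueness clause of Thm. A (`Varma2024.corollary93_unramified_of_regularAlgebraic`),
and the leaf gives the item (`of_corollary93_unramified`).  So the discharge of ANY of the three
existing named facts `Varma2024.theorem1_unramified_traces`, `Varma2024.corollary93_unramified`,
`exists_galoisRep_of_regularAlgebraic` closes the item in one line.
[cite: HarrisLanTaylorThorneRMS2016, Thm. A (p. 3)] [cite: VarmaFMS2024, Cor. 9.3 (p. 32)] -/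
theorem of_exists_galoisRep_of_regularAlgebraic (hS : exists_galoisRep_of_regularAlgebraic) :
    ∀ {n : ℕ} {K : Type} [Field K] [NumberField K] (hcpt : isCompact_glFiniteIntegralLevel n K),
      IsTotallyReal K ∨ IsCMField K →
      ∀ (π : CuspidalAutomorphicRepData n K hcpt), π.1.IsRegularAlgebraic →
      ∀ (ℓ : ℕ) [Fact ℓ.Prime] (ι : PadicAlgCl ℓ ≃+* ℂ) (r : FramedGaloisRep K (PadicAlgCl ℓ) n),
        r.toGaloisRep.IsSemisimple → IsCompatible π.1 ι r →
        ∀ (v : HeightOneSpectrum (𝓞 K)), ((ℓ : ℕ) : 𝓞 K) ∉ v.asIdeal →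
        ∀ (α : Multiset ℂ), π.1.HasSatakeParamAt v α →
        ∀ (σ : absoluteGaloisGroup (v.adicCompletion K)) (d : ℤ), d ≠ 0 → IsFrobPow σ d →
          (((r.toLocal v) σ : GL (Fin n) (PadicAlgCl ℓ)) : Matrix (Fin n) (Fin n) (PadicAlgCl ℓ)).trace
            = ((arithFrobPolyOfSatake ι v.residueCard n α).roots.map fun b => b ^ d).sum :=
  fun hcpt hK => of_corollary93_unramified (Varma2024.corollary93_unramified_of_regularAlgebraic hS) hcpt hK

/-! ### The item from the Literature named fact `theorem1_unramified_traces` -/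

/-- **The item from Varma's Theorem 1 in trace form** (the Literature named fact
`Varma2024.theorem1_unramified_traces`, of which the item is the restriction to non-zero degree).
[cite: VarmaFMS2024, Thm. 1 (p. 2) and Cor. 9.3 (p. 32)] -/
theorem of_theorem1_unramified_traces (hV : Varma2024.theorem1_unramified_traces) :
    ∀ {n : ℕ} {K : Type} [Field K] [NumberField K] (hcpt : isCompact_glFiniteIntegralLevel n K),
      IsTotallyReal K ∨ IsCMField K →
      ∀ (π : CuspidalAutomorphicRepData n K hcpt), π.1.IsRegularAlgebraic →
      ∀ (ℓ : ℕ) [Fact ℓ.Prime] (ι : PadicAlgCl ℓ ≃+* ℂ) (r : FramedGaloisRep K (PadicAlgCl ℓ) n),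
        r.toGaloisRep.IsSemisimple → IsCompatible π.1 ι r →
        ∀ (v : HeightOneSpectrum (𝓞 K)), ((ℓ : ℕ) : 𝓞 K) ∉ v.asIdeal →
        ∀ (α : Multiset ℂ), π.1.HasSatakeParamAt v α →
        ∀ (σ : absoluteGaloisGroup (v.adicCompletion K)) (d : ℤ), d ≠ 0 → IsFrobPow σ d →
          (((r.toLocal v) σ : GL (Fin n) (PadicAlgCl ℓ)) : Matrix (Fin n) (Fin n) (PadicAlgCl ℓ)).trace
            = ((arithFrobPolyOfSatake ι v.residueCard n α).roots.map fun b => b ^ d).sum :=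
  fun hcpt hK π hπ ℓ _ ι r hr hc v hv α hα σ d _ hσ => hV hcpt hK π hπ ℓ ι r hr hc v hv α hα σ d hσ

/-! ### Isolated places: the item wherever `v` is the only place over its rational prime; `K = ℚ` -/

/-- **The item at an isolated place, unconditionally.**  For any number field `K`, any `π` and any
`r` with Harris–Lan–Taylor–Thorne's property `IsCompatible π ι r`: if the place `v ∤ ℓ` is the ONLY
place of `K` above its rational prime `q` (e.g. `q` inert or totally ramified in `K`), then a Satake
parameter `α` of `π` at `v` already makes `π` unramified above `q` in the sense of Thm. A
(`IsUnramifiedAbove`), so Thm. A alone gives the Weil traces at `v` in every degree `d`: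
`tr r(σ) = ∑_b b ^ d` over the roots `b` of `arithFrobPolyOfSatake ι q_v n α`.  (The coupling of the
places above one rational prime in Thm. A is the whole difference between Thm. A and Varma's Thm. 1
at unramified places; at an isolated place there is nothing to couple.)
[cite: HarrisLanTaylorThorneRMS2016, Thm. A (p. 3)] [cite: TateCorvallis1979, §4.2 (4.2.1)] -/
theorem trace_toLocal_eq_of_isCompatible_of_forall_place_eq {n : ℕ} {K : Type} [Field K]
    [NumberField K] {hcpt : isCompact_glFiniteIntegralLevel n K} {ℓ : ℕ} [Fact ℓ.Prime]
    (π : AutomorphicRepData (AutomorphyDatum.gl n K hcpt)) (ι : PadicAlgCl ℓ ≃+* ℂ)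
    (r : FramedGaloisRep K (PadicAlgCl ℓ) n) (hc : IsCompatible π ι r)
    (v : HeightOneSpectrum (𝓞 K)) (hv : ((ℓ : ℕ) : 𝓞 K) ∉ v.asIdeal)
    {q : ℕ} (hq : q.Prime) (hqv : ((q : ℕ) : 𝓞 K) ∈ v.asIdeal)
    (huniq : ∀ w : HeightOneSpectrum (𝓞 K), ((q : ℕ) : 𝓞 K) ∈ w.asIdeal → w = v)
    (α : Multiset ℂ) (hα : π.HasSatakeParamAt v α)
    (σ : absoluteGaloisGroup (v.adicCompletion K)) (d : ℤ) (hσ : IsFrobPow σ d) :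
    (((r.toLocal v) σ : GL (Fin n) (PadicAlgCl ℓ)) : Matrix (Fin n) (Fin n) (PadicAlgCl ℓ)).trace
      = ((arithFrobPolyOfSatake ι v.residueCard n α).roots.map fun b => b ^ d).sum := by
  have hqℓ : q ≠ ℓ := fun h => hv (h ▸ hqv)
  have hπq : π.IsUnramifiedAbove q :=
    (AutomorphicRepData.isUnramifiedAbove_iff π q).2 fun w hw => by
      rw [huniq w hw]
      exact ⟨α, hα⟩
  exact trace_toLocal_eq_of_isCompatible_of_isUnramifiedAbove π ι r hc hq hqℓ hπq v hqv α hα σ d hσ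

/-- Over `ℚ` every rational prime has exactly one place above it (`𝓞 ℚ = ℤ`, Mathlib
`Rat.ringOfIntegersEquiv`): two finite places of `ℚ` containing the same rational prime `q` coincide
(their contractions to `ℤ` are proper ideals containing the maximal ideal `(q)`). [folklore] -/
theorem heightOneSpectrum_rat_eq_of_natCast_mem {q : ℕ} (hq : q.Prime)
    {v w : HeightOneSpectrum (𝓞 ℚ)} (hv : ((q : ℕ) : 𝓞 ℚ) ∈ v.asIdeal)
    (hw : ((q : ℕ) : 𝓞 ℚ) ∈ w.asIdeal) : w = v := by
  -- `ℤ → 𝓞 ℚ` is surjective (an isomorphism; any two ring maps out of `ℤ` agree)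
  have hsurj : Function.Surjective (algebraMap ℤ (𝓞 ℚ)) := by
    rw [show algebraMap ℤ (𝓞 ℚ) = Rat.ringOfIntegersEquiv.symm.toRingHom from Subsingleton.elim _ _]
    exact Rat.ringOfIntegersEquiv.symm.surjective
  have hmax : (Ideal.span {((q : ℕ) : ℤ)}).IsMaximal :=
    PrincipalIdealRing.isMaximal_of_irreducible (Nat.prime_iff_prime_int.mp hq).irreducible
  have key : ∀ u : HeightOneSpectrum (𝓞 ℚ), ((q : ℕ) : 𝓞 ℚ) ∈ u.asIdeal →
      u.asIdeal.comap (algebraMap ℤ (𝓞 ℚ)) = Ideal.span {((q : ℕ) : ℤ)} := fun u hu => by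
    refine (hmax.eq_of_le (Ideal.comap_ne_top _ u.isPrime.ne_top) ?_).symm
    rw [Ideal.span_singleton_le_iff_mem, Ideal.mem_comap, map_natCast]
    exact hu
  have h : w.asIdeal = v.asIdeal :=
    Ideal.comap_injective_of_surjective _ hsurj ((key w hw).trans (key v hv).symm)
  exact HeightOneSpectrum.ext h

/-- **The item over `ℚ`, unconditionally** (indeed for ANY automorphic `π` of `GL_n(𝔸_ℚ)` and any
`r : Γ_ℚ → GL_n(ℚ̄_ℓ)` with Harris–Lan–Taylor–Thorne's property `IsCompatible π ι r`, in every
degree `d`): at every prime `p ≠ ℓ` at which `π` has a Satake parameter `α`, every `σ ∈ Γ_{ℚ_p}`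
of Frobenius degree `d` has `tr r(σ) = ∑_b b ^ d` over the roots `b` of
`arithFrobPolyOfSatake ι p n α`.  Over `ℚ` the hypothesis "`π` unramified above the rational prime"
of Thm. A is just "`π_p` unramified" (`heightOneSpectrum_rat_eq_of_natCast_mem`), so the text of the
item `VarmaWeilTracesUnramified` (stmt-Langlands-15004) specialised to `K = ℚ` needs no input from
Varma 2024. [cite: HarrisLanTaylorThorneRMS2016, Thm. A (p. 3)] [cite: TateCorvallis1979, §4.2 (4.2.1)] -/
theorem of_rat {n : ℕ} {hcpt : isCompact_glFiniteIntegralLevel n ℚ} {ℓ : ℕ} [Fact ℓ.Prime]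
    (π : AutomorphicRepData (AutomorphyDatum.gl n ℚ hcpt)) (ι : PadicAlgCl ℓ ≃+* ℂ)
    (r : FramedGaloisRep ℚ (PadicAlgCl ℓ) n) (hc : IsCompatible π ι r)
    (v : HeightOneSpectrum (𝓞 ℚ)) (hv : ((ℓ : ℕ) : 𝓞 ℚ) ∉ v.asIdeal)
    (α : Multiset ℂ) (hα : π.HasSatakeParamAt v α)
    (σ : absoluteGaloisGroup (v.adicCompletion ℚ)) (d : ℤ) (hσ : IsFrobPow σ d) :
    (((r.toLocal v) σ : GL (Fin n) (PadicAlgCl ℓ)) : Matrix (Fin n) (Fin n) (PadicAlgCl ℓ)).trace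
      = ((arithFrobPolyOfSatake ι v.residueCard n α).roots.map fun b => b ^ d).sum := by
  obtain ⟨q, hq, hqv⟩ := exists_natPrime_natCast_mem v
  exact trace_toLocal_eq_of_isCompatible_of_forall_place_eq π ι r hc v hv hq hqv
    (fun w hw => heightOneSpectrum_rat_eq_of_natCast_mem hq hqv hw) α hα σ d hσ

end Summit.Langlands.Langlands.Theorems.VarmaWeilTracesUnramified

end
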